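import Summits.PneNP.PneNP.Theorems.ExpanderLinearGeneratorsMoorePhaseOne
import Summits.PneNP.PneNP.Theorems.ExpanderLinearGeneratorsMoorePhaseTwo

/-!
# A Moore-type bound for `(r, 6)`-boundary expanders with `8`-point scopes, VI: the bound
(route ExpanderLinearGenerators, item stmt-PneNP-11442, helper file)

Assembly of files I–V into the combinatorial statement used by the `ℓ = 8` slice of
`ExpansionForcesDepthFregeSize`:

`card_le_of_boundaryless` — if a finite family `F` of scopes with `4 ≤ |S a| ≤ 8` points each is
CLOSED (every point of a scope of `F` lies in a second scope of `F`, i.e. `∂F = ∅`) and the scopes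
form an `(r, 6)`-boundary expander, then `|F| ≥ 2^N` whenever `8N + 8 ≤ r`.

Proof: realise the incidence graph as a `SimpleGraph` (`fromRel`), grow an exploration tree from
any row (`exists_tree`: the local axioms `H1`–`H5` of file II can be met because rows have `≥ 4`
points and the family is closed); by phase one (file III) its labels are injective up to level `N`
— giving `2^N` rows — unless the graph has a cycle `Z` of length `≤ 4N + 2`; in that case grow a
second tree from a row of `Z` through points off `Z`; by phase two (file V) its labels are injective
up to level `N`, giving `2^N` rows again.
-/

namespace Summit.PneNP.PneNP.Theorems

set_option linter.dupNamespace false -- `Summit.PneNP.PneNP.…`: summit = sub-problem (D-0017)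

namespace MooreBound

open Finset SimpleGraph Literature.Computability.MetaComplexity

variable {ι : Type*} {S : ι → Finset ℕ} {F : Finset ι}

/-- The incidence graph as a `SimpleGraph`: `fromRel` of "row of `F` — point of its scope" has the
adjacency relation assumed throughout files I–V. [folklore] -/
theorem fromRel_incidence_adj (x y : ι ⊕ ℕ) :
    (SimpleGraph.fromRel fun x y : ι ⊕ ℕ => ∃ a v, a ∈ F ∧ v ∈ S a ∧ x = Sum.inl a ∧
      y = Sum.inr v).Adj x y ↔
    ∃ a v, a ∈ F ∧ v ∈ S a ∧
      ((x = Sum.inl a ∧ y = Sum.inr v) ∨ (x = Sum.inr v ∧ y = Sum.inl a)) := by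
  rw [SimpleGraph.fromRel_adj]
  constructor
  · rintro ⟨-, ⟨a, v, ha, hv, rfl, rfl⟩ | ⟨a, v, ha, hv, rfl, rfl⟩⟩
    · exact ⟨a, v, ha, hv, Or.inl ⟨rfl, rfl⟩⟩
    · exact ⟨a, v, ha, hv, Or.inr ⟨rfl, rfl⟩⟩
  · rintro ⟨a, v, ha, hv, ⟨rfl, rfl⟩ | ⟨rfl, rfl⟩⟩
    · exact ⟨Sum.inl_ne_inr, Or.inl ⟨a, v, ha, hv, rfl, rfl⟩⟩
    · exact ⟨Sum.inr_ne_inl, Or.inr ⟨a, v, ha, hv, rfl, rfl⟩⟩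

/-- **Exploration trees exist.** In a closed family whose rows have at least `4` points one can
grow, from any row `b` of the family and avoiding any `≤ 2` prescribed points at the root, a
binary exploration tree satisfying the local axioms `H1`–`H5` of file II: label the root by `b`;
at a node labelled `a` entered through `x`, pick two distinct points of `S a` other than `x`
(other than the prescribed points, at the root) and, through each, a second row of the family
containing it. [folklore] -/
theorem exists_tree (hcl : ∀ a ∈ F, ∀ v ∈ S a, ∃ a' ∈ F, a' ≠ a ∧ v ∈ S a')
    (h4 : ∀ a ∈ F, 4 ≤ (S a).card) {b : ι} (hb : b ∈ F) (Φ : Finset ℕ) (hΦ : Φ.card ≤ 2) :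
    ∃ (ρ : List Bool → ι) (φ : List Bool → ℕ), ρ [] = b ∧ (∀ w, ρ w ∈ F) ∧
      (∀ c w, φ (c :: w) ∈ S (ρ w) ∧ φ (c :: w) ∈ S (ρ (c :: w))) ∧
      (∀ c w, ρ (c :: w) ≠ ρ w) ∧ (∀ w, φ (false :: w) ≠ φ (true :: w)) ∧
      (∀ c c' w, φ (c :: c' :: w) ≠ φ (c' :: w)) ∧ (∀ c, φ [c] ∉ Φ) := by
  classical
  -- two distinct admissible points at a row
  have hpick : ∀ (a : ι) (Ψ : Finset ℕ), ∃ p : ℕ × ℕ, a ∈ F → Ψ.card ≤ 2 →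
      (p.1 ∈ S a ∧ p.1 ∉ Ψ ∧ p.2 ∈ S a ∧ p.2 ∉ Ψ ∧ p.1 ≠ p.2) := by
    intro a Ψ
    by_cases h : a ∈ F ∧ Ψ.card ≤ 2
    · have hcard : 1 < (S a \ Ψ).card := by
        have := Finset.le_card_sdiff Ψ (S a)
        have := h4 a h.1
        omega
      obtain ⟨y₀, hy₀, y₁, hy₁, hne⟩ := Finset.one_lt_card.1 hcard
      rw [Finset.mem_sdiff] at hy₀ hy₁
      exact ⟨(y₀, y₁), fun _ _ => ⟨hy₀.1, hy₀.2, hy₁.1, hy₁.2, hne⟩⟩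
    · exact ⟨(0, 0), fun ha hΨ => absurd ⟨ha, hΨ⟩ h⟩
  choose pick hpick using hpick
  -- a second row through a point
  have hpartner : ∀ (a : ι) (y : ℕ), ∃ a' : ι, a ∈ F → y ∈ S a → (a' ∈ F ∧ a' ≠ a ∧ y ∈ S a') := by
    intro a y
    by_cases h : a ∈ F ∧ y ∈ S a
    · obtain ⟨a', ha', hne, hy⟩ := hcl a h.1 y h.2
      exact ⟨a', fun _ _ => ⟨ha', hne, hy⟩⟩
    · exact ⟨a, fun ha hy => absurd ⟨ha, hy⟩ h⟩
  choose partner hpartner using hpartner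
  -- the tree, by recursion on the node (most recent step first)
  let sel : Bool → ℕ × ℕ → ℕ := fun c p => if c then p.2 else p.1
  let step : Bool → List Bool → ι × ℕ → ι × ℕ := fun c w ih =>
    (partner ih.1 (sel c (pick ih.1 (if w = [] then Φ else {ih.2}))),
      sel c (pick ih.1 (if w = [] then Φ else {ih.2})))
  let st : List Bool → ι × ℕ := fun w => w.rec (b, 0) step
  have hst0 : st [] = (b, 0) := rfl
  have hsts : ∀ c w, st (c :: w) = step c w (st w) := fun _ _ => rfl
  -- admissibility of the forbidden sets along the tree
  have hΨ : ∀ w : List Bool, (if w = [] then Φ else ({(st w).2} : Finset ℕ)).card ≤ 2 := by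
    intro w
    split_ifs
    · exact hΦ
    · simp
  -- rows stay in the family
  have hF : ∀ w, (st w).1 ∈ F := by
    intro w
    induction w with
    | nil => simpa [hst0] using hb
    | cons c w ih =>
      rw [hsts]
      have hp := hpick (st w).1 _ ih (hΨ w)
      have hy : sel c (pick (st w).1 (if w = [] then Φ else {(st w).2})) ∈ S (st w).1 := by
        cases c
        · exact hp.1
        · exact hp.2.2.1
      exact (hpartner _ _ ih hy).1
  -- the chosen point lies in the current row and avoids the forbidden set
  have hsel : ∀ (c : Bool) (w : List Bool),
      sel c (pick (st w).1 (if w = [] then Φ else {(st w).2})) ∈ S (st w).1 ∧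
      sel c (pick (st w).1 (if w = [] then Φ else {(st w).2})) ∉
        (if w = [] then Φ else ({(st w).2} : Finset ℕ)) := by
    intro c w
    have hp := hpick (st w).1 _ (hF w) (hΨ w)
    cases c
    · exact ⟨hp.1, hp.2.1⟩
    · exact ⟨hp.2.2.1, hp.2.2.2.1⟩
  refine ⟨fun w => (st w).1, fun w => (st w).2, ?_, hF, ?_, ?_, ?_, ?_, ?_⟩
  · show (st []).1 = b
    rw [hst0]
  · intro c w
    show (st (c :: w)).2 ∈ S (st w).1 ∧ (st (c :: w)).2 ∈ S (st (c :: w)).1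
    rw [hsts]
    exact ⟨(hsel c w).1, (hpartner _ _ (hF w) (hsel c w).1).2.2⟩
  · intro c w
    show (st (c :: w)).1 ≠ (st w).1
    rw [hsts]
    exact (hpartner _ _ (hF w) (hsel c w).1).2.1
  · intro w
    show (st (false :: w)).2 ≠ (st (true :: w)).2
    rw [hsts, hsts]
    have hp := hpick (st w).1 _ (hF w) (hΨ w)
    simpa [step, sel] using hp.2.2.2.2
  · intro c c' w
    show (st (c :: c' :: w)).2 ≠ (st (c' :: w)).2
    have h := (hsel c (c' :: w)).2
    simp only [reduceCtorEq, if_false, Finset.mem_singleton] at h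
    rw [hsts c (c' :: w)]
    exact h
  · intro c
    show (st (c :: [])).2 ∉ Φ
    have h := (hsel c []).2
    simp only [if_true] at h
    rw [hsts c []]
    exact h

/-- **The Moore-type bound.** A nonempty CLOSED family `F` of scopes (every point of a scope of `F`
lies in a second scope of `F`) with `4 ≤ |S a| ≤ 8` points per scope, forming an
`(r, 6)`-boundary expander, has at least `2^N` members whenever `8N + 8 ≤ r`. [folklore] -/
theorem card_le_of_boundaryless [DecidableEq ι] (hFne : F.Nonempty)
    (hcl : ∀ a ∈ F, ∀ v ∈ S a, ∃ a' ∈ F, a' ≠ a ∧ v ∈ S a') (h4 : ∀ a ∈ F, 4 ≤ (S a).card)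
    (hS8 : ∀ a ∈ F, (S a).card ≤ 8) {r : ℝ} (hexp : IsBoundaryExpander S r 6) (N : ℕ)
    (hN : ((8 * N + 8 : ℕ) : ℝ) ≤ r) : 2 ^ N ≤ F.card := by
  classical
  set G := SimpleGraph.fromRel fun x y : ι ⊕ ℕ => ∃ a v, a ∈ F ∧ v ∈ S a ∧ x = Sum.inl a ∧
    y = Sum.inr v with hGdef
  have hG : ∀ x y, G.Adj x y ↔ ∃ a v, a ∈ F ∧ v ∈ S a ∧
      ((x = Sum.inl a ∧ y = Sum.inr v) ∨ (x = Sum.inr v ∧ y = Sum.inl a)) :=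
    fromRel_incidence_adj
  obtain ⟨a₀, ha₀⟩ := hFne
  obtain ⟨ρ, φ, -, H1, H2, H3, H4, H5, -⟩ := exists_tree hcl h4 ha₀ ∅ (by simp)
  rcases phaseOne hG H1 H2 H3 H4 H5 N with ⟨hIR, -⟩ | ⟨b, Z, hZ, hZl⟩
  · exact card_le_of_injective_labels H1 N hIR
  · -- a short cycle through the row `b`: grow a second tree from `b` off the cycle
    have hb : b ∈ F := by
      obtain ⟨v, -, hb, -⟩ := (adj_inl_iff hG).1 (Z.adj_snd hZ.not_nil)
      exact hb
    set Φ : Finset ℕ := (S b).filter fun q => Sum.inr q = Z.snd ∨ Sum.inr q = Z.penultimate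
      with hΦdef
    have hΦ : Φ.card ≤ 2 := by
      calc Φ.card = (Φ.image fun q => (Sum.inr q : ι ⊕ ℕ)).card :=
            (Finset.card_image_of_injective _ Sum.inr_injective).symm
        _ ≤ ({Z.snd, Z.penultimate} : Finset (ι ⊕ ℕ)).card := by
            refine Finset.card_le_card fun x hx => ?_
            obtain ⟨q, hq, rfl⟩ := Finset.mem_image.1 hx
            rcases (Finset.mem_filter.1 hq).2 with h | h <;> simp [h]
        _ ≤ 2 := Finset.card_le_two
    obtain ⟨ρ₂, φ₂, hρ0, K1, K2, K3, K4, K5, K7⟩ := exists_tree hcl h4 hb Φ hΦ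
    subst hρ0
    have K6 : ∀ c, Sum.inr (φ₂ [c]) ≠ Z.snd ∧ Sum.inr (φ₂ [c]) ≠ Z.penultimate := by
      intro c
      have hmem : φ₂ [c] ∈ S (ρ₂ []) := (K2 c []).1
      have hnot := K7 c
      rw [hΦdef, Finset.mem_filter, not_and_or] at hnot
      rcases hnot with h | h
      · exact absurd hmem h
      · exact not_or.1 h
    refine card_le_of_injective_labels K1 N (phaseTwo hG K1 K2 K3 K4 K5 hZ K6 hS8 hexp N ?_)
    exact le_trans (by exact_mod_cast (by omega : Z.length + 4 * N + 6 ≤ 8 * N + 8)) hN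

end MooreBound

end Summit.PneNP.PneNP.Theorems
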